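import Literature.NumberTheory.Sieve.HardyLittlewoodTwinSieveBFIRemainder
import HarnessLib

/-!
# The twin-prime sieve constant `7/2` from Bombieri–Friedlander–Iwaniec's Theorem 10 (conditional)

Topic `Literature/NumberTheory/Sieve`; second of two files proving the CONDITIONAL reduction
`Literature.NumberTheory.Sieve.twinSieve_bfi_of_theorem10Pi :
  BombieriFriedlanderIwaniecTheorem10Pi → twinSieve_bfi`,
i.e. Bombieri–Friedlander–Iwaniec, Acta Math. 156 (1986), §1 **Corollary 2** (`π₂(x) ≤ (7/2 + ε) B x/log²x`,
`B = 2 C₂`) from their **Theorem 10** in the `π`-form (`BombieriFriedlanderIwaniecTheorem10Pi`, a named fact of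
the tree whose proof — Theorems 1, 2, 5* of the paper — is in progress elsewhere) exactly as printed on
p. 251: "Corollary 2 is an immediate consequence of Theorem 10 and of the linear sieve result of [15]."
The linear sieve result of [15] with WELL-FACTORABLE remainder is the PROVED
`Iwaniec1980b.WF.sifted_le_wellFactorable`.

The argument (`TwinSieveBFI.eventually_twinPrimeCount_le`): sieve `𝒜(x) = {p + 2 : 2 < p ≤ x}` at
`z = x^{γ/2}`, `D = x^γ`, `γ = (4/7 − ε_B)/(1 + ε_I⁹ + 2ε_I)`, so that the well-factorable level
`Q = D^{1+η+2ε_I}` is `x^{4/7−ε_B}`; the main term is `(π(x) − 1) V(z) (F(2) + E)` with `F(2) = e^γ`,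
`V(z) log x → (4/γ) C₂ e^{−γ}` (Mertens), `E → c₀ ε_I`; each of the `≤ L₁(ε_I)` well-factorable remainder
sums is `≪ x/log³x` by Theorem 10 (`a = −2`, `A = 3`) plus a trivial `≤ x^{4/7}`; the junk moduli contribute
`≪ x (log x)⁵ / x^{γ ε_I²}`.  Hence `π₂(x) ≤ ((2/γ)(1 + c₀ ε_I e^{−γ}) + o(1)) · 2C₂ x/log²x`, and
`ε_I, ε_B → 0` give every constant `> 7/2` (`TwinSieveBFI.twinSieveUpperBound_of_theorem10Pi`).

Everything here is PROVED; the only hypothesis is the named fact `BombieriFriedlanderIwaniecTheorem10Pi`.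

## References

* E. Bombieri, J. B. Friedlander, H. Iwaniec, *Primes in arithmetic progressions to large moduli*, Acta Math.
  156 (1986), 203–251: §1 Theorem 10, Corollary 2; §17 (p. 251). [BombieriFriedlanderIwaniecActa1986]
* H. Iwaniec, *A new form of the error term in the linear sieve*, Acta Arith. 37 (1980), 307–320, Theorem 1.
  [IwaniecActaArith1980b]
-/

open Finset Filter Topology

noncomputable section

namespace Literature.NumberTheory.Sieve

namespace TwinSieveBFI

open Chen ChenSieve SieveSequence Iwaniec1980b

/-! ### Elementary limits -/

/-- `(1 + log x)^5 / x^a → 0` along `ℕ` for `a > 0`. [folklore] -/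
theorem tendsto_one_add_log_pow_div_rpow (a : ℝ) (ha : 0 < a) :
    Tendsto (fun x : ℕ => (1 + Real.log (x : ℝ)) ^ 5 / (x : ℝ) ^ a) atTop (𝓝 0) := by
  have h := (isLittleO_log_rpow_rpow_atTop (5 : ℝ) ha).tendsto_div_nhds_zero
  have h32 : Tendsto (fun x : ℝ => 32 * (Real.log x ^ (5 : ℝ) / x ^ a)) atTop (𝓝 0) := by
    have := h.const_mul 32; rwa [mul_zero] at this
  have h' := h32.comp tendsto_natCast_atTop_atTop
  refine squeeze_zero' ?_ ?_ h'
  · filter_upwards [eventually_gt_atTop 0] with x hx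
    have hx0 : (0 : ℝ) < x := by exact_mod_cast hx
    have : 0 ≤ Real.log (x : ℝ) := Real.log_nonneg (by exact_mod_cast hx)
    positivity
  · filter_upwards [(Real.tendsto_log_atTop.comp tendsto_natCast_atTop_atTop).eventually_ge_atTop 1,
      eventually_gt_atTop 0] with x hx hx0
    have hx0' : (0 : ℝ) < x := by exact_mod_cast hx0
    simp only [Function.comp_apply] at hx ⊢
    rw [mul_div_assoc']
    apply div_le_div_of_nonneg_right _ (Real.rpow_nonneg hx0'.le _)
    rw [show (5 : ℝ) = ((5 : ℕ) : ℝ) by norm_num, Real.rpow_natCast]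
    have h1 : 1 + Real.log (x : ℝ) ≤ 2 * Real.log x := by linarith
    calc (1 + Real.log (x : ℝ)) ^ 5 ≤ (2 * Real.log x) ^ 5 := by gcongr
      _ = 32 * Real.log x ^ 5 := by ring

/-! ### The eventual bound with explicit parameters -/

set_option maxHeartbeats 1600000 in
/-- **The sieve bound for twin primes at the Bombieri–Friedlander–Iwaniec level** (conditional on
`BombieriFriedlanderIwaniecTheorem10Pi`).  For `0 < ε_I ≤ 1/30`, `0 < ε_B ≤ 1/7`, a decay constant `C_d` of
the linear-sieve functions, and every `τ > 0`: eventually in `x`,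
`π₂(x) ≤ ((2/γ)(1 + c₀ ε_I e^{−γ_E}) + τ) · 2 C₂ x/(log x)²`, where `γ = (4/7 − ε_B)/(1 + ε_I⁹ + 2ε_I)` and
`c₀ = 5·10²⁴ (1 + C_d)²`.  Proof: `π₂(x) ≤ S(𝒜(x), z) + z + 1`; Iwaniec's linear sieve with well-factorable
remainder (`Iwaniec1980b.WF.sifted_le_wellFactorable`) at `D = x^γ`, `z = D^{1/2}`; the `≤ L₁(ε_I)`
well-factorable sums of level `x^{4/7−ε_B}` by Theorem 10 (`π`-form, `a = −2`, `A = 3`); the junk moduli by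
`sum_junkSet_abs_remainder_le`; Mertens and the prime number theorem for the main term.
[cite: BombieriFriedlanderIwaniecActa1986, §1 Corollary 2 and §17 p. 251] -/
theorem eventually_twinPrimeCount_le (h10 : BombieriFriedlanderIwaniecTheorem10Pi)
    {εI εB : ℝ} (hεI : 0 < εI) (hεI1 : εI ≤ 1 / 30) (hεB : 0 < εB) (hεB1 : εB ≤ 1 / 7)
    {Cd : ℝ} (hCd : 0 ≤ Cd)
    (hCdF : ∀ s : ℝ, 1 ≤ s → |upperSieveFun 1 s - 1| ≤ Cd * Real.exp (-s))
    (hCdf : ∀ s : ℝ, 2 ≤ s → |lowerSieveFun 1 s - 1| ≤ Cd * Real.exp (-s)) {τ : ℝ} (hτ : 0 < τ) :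
    ∀ᶠ x : ℕ in atTop,
      (twinPrimeCount x : ℝ) ≤
        (2 / ((4 / 7 - εB) / (1 + Core.eta εI + 2 * εI)) *
              (1 + 5e24 * (1 + Cd) ^ 2 * εI * Real.exp (-Real.eulerMascheroniConstant)) + τ) *
          2 * twinPrimeConst * x / Real.log x ^ 2 := by
  -- constants
  set G := Real.exp Real.eulerMascheroniConstant with hG
  have hG0 : 0 < G := Real.exp_pos _
  set η := Core.eta εI with hη
  have hη0 : 0 < η := Core.eta_pos hεI
  have hη1 : η ≤ 1 := by
    rw [hη, Core.eta]; exact pow_le_one₀ hεI.le (by linarith)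
  set e₁ := 1 + η + 2 * εI with he₁
  have he₁1 : 1 ≤ e₁ := by rw [he₁]; linarith
  set θ' := 4 / 7 - εB with hθ'
  have hθ'0 : 0 < θ' := by rw [hθ']; linarith
  have hθ'1 : θ' < 1 := by rw [hθ']; linarith
  set γ := θ' / e₁ with hγ
  have hγ0 : 0 < γ := div_pos hθ'0 (by linarith)
  have hγθ : γ * e₁ = θ' := by rw [hγ]; field_simp
  have hγ1 : γ < 1 := by
    have : γ ≤ θ' := by rw [hγ]; exact div_le_self hθ'0.le he₁1
    linarith
  set K := 54 * Real.exp (54 / Real.log 2) with hK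
  have hK1 : 1 ≤ K := by
    rw [hK]; nlinarith [Real.one_le_exp (by positivity : (0:ℝ) ≤ 54 / Real.log 2)]
  set c₀ := 5e24 * (1 + Cd) ^ 2 with hc₀
  have hc₀0 : 0 ≤ c₀ := by positivity
  set L₁ : ℝ := (Core.Lone εI : ℝ) with hL₁
  have hL₁0 : 0 ≤ L₁ := Nat.cast_nonneg _
  -- Theorem 10 at `a = -2`, `A = 3`, `ε = εB`
  obtain ⟨C, x₀, hC0, hx₀2, hC⟩ := h10.bound_nonneg (a := -2) (by norm_num) (A := 3) (by norm_num) hεB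
  -- the majorant
  set E : ℕ → ℝ := fun x => c₀ * (εI + εI⁻¹ ^ 8 * Real.exp K / (γ * Real.log x)) with hE
  set M : ℕ → ℝ := fun x =>
    ((Nat.primeCounting x : ℝ) - 1) * sieveProduct 2 ((x : ℝ) ^ (γ / 2)) * (G + E x) +
      L₁ * (C * x / Real.log x ^ 3 + (x : ℝ) ^ θ') +
      L₁ * (8 * x * (1 + Real.log x) ^ 3 / (x : ℝ) ^ (γ * εI ^ 2)) +
      ((x : ℝ) ^ (γ / 2) + 1) with hM
  -- (a) eventually `π₂(x) ≤ M(x)`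
  have hlog := Real.tendsto_log_atTop.comp tendsto_natCast_atTop_atTop
  have hle : ∀ᶠ x : ℕ in atTop, (twinPrimeCount x : ℝ) ≤ M x := by
    filter_upwards [eventually_ge_atTop 2, tendsto_natCast_atTop_atTop.eventually_ge_atTop x₀,
      hlog.eventually_ge_atTop ((200 * K) ^ 2 / γ + 200 * K / (εI ^ 2 * γ) + (30 / εI) ^ 2 / γ + 1),
      ((tendsto_rpow_atTop (by positivity : 0 < γ / 2)).comp tendsto_natCast_atTop_atTop).eventually_ge_atTop 2]
      with x hx2 hxx₀ hlogx hz2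
    simp only [Function.comp_apply] at hlogx hz2
    have hx1 : (1 : ℝ) < x := by exact_mod_cast (show 1 < x by omega)
    have hx0 : (0 : ℝ) < x := by linarith
    have hlog0 : 0 < Real.log x := Real.log_pos hx1
    -- parameters at `x`
    set D : ℝ := (x : ℝ) ^ γ with hDdef
    set z : ℝ := (x : ℝ) ^ (γ / 2) with hzdef
    have hD1 : 1 < D := Real.one_lt_rpow hx1 hγ0
    have hD0 : 0 < D := by linarith
    have hlogD : Real.log D = γ * Real.log x := by rw [hDdef, Real.log_rpow hx0]
    have hlogz : Real.log z = γ / 2 * Real.log x := by rw [hzdef, Real.log_rpow hx0]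
    have hzD : z ≤ D := by
      rw [hzdef, hDdef]; exact Real.rpow_le_rpow_of_exponent_le hx1.le (by linarith)
    have hz0 : 0 ≤ z := by linarith
    have hratio : Real.log D / Real.log z = 2 := by
      rw [hlogD, hlogz]; field_simp
    -- the regime
    have hγlog : γ * Real.log x ≥ (200 * K) ^ 2 + 200 * K / εI ^ 2 + (30 / εI) ^ 2 := by
      have h1 : (200 * K) ^ 2 / γ + 200 * K / (εI ^ 2 * γ) + (30 / εI) ^ 2 / γ ≤ Real.log x := by linarith
      have h2 := mul_le_mul_of_nonneg_left h1 hγ0.le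
      have e1 : γ * ((200 * K) ^ 2 / γ + 200 * K / (εI ^ 2 * γ) + (30 / εI) ^ 2 / γ) =
          (200 * K) ^ 2 + 200 * K / εI ^ 2 + (30 / εI) ^ 2 := by field_simp
      linarith
    have hKpos : 0 < 200 * K := by linarith
    have hKu : 200 * K ≤ εI ^ 2 * Real.log D := by
      rw [hlogD]
      have h1 : 200 * K / εI ^ 2 ≤ γ * Real.log x := by
        have : (0:ℝ) ≤ (200 * K) ^ 2 := sq_nonneg _
        have : (0:ℝ) ≤ (30 / εI) ^ 2 := sq_nonneg _
        linarith
      have h2 := mul_le_mul_of_nonneg_left h1 (sq_nonneg εI)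
      rw [mul_div_cancel₀ _ (by positivity)] at h2
      linarith
    have hsqrt : Real.sqrt (Real.log D) ≥ 200 * K ∧ εI * Real.sqrt (Real.log D) ≥ 30 := by
      rw [hlogD]
      constructor
      · refine Real.le_sqrt_of_sq_le ?_
        have : (0:ℝ) ≤ 200 * K / εI ^ 2 := by positivity
        have : (0:ℝ) ≤ (30 / εI) ^ 2 := sq_nonneg _
        linarith
      · have h1 : (30 / εI) ^ 2 ≤ γ * Real.log x := by
          have : (0:ℝ) ≤ (200 * K) ^ 2 := sq_nonneg _
          have : (0:ℝ) ≤ 200 * K / εI ^ 2 := by positivity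
          linarith
        have h2 : 30 / εI ≤ Real.sqrt (γ * Real.log x) := Real.le_sqrt_of_sq_le h1
        rw [div_le_iff₀ hεI] at h2
        linarith
    -- `u = D^{εI²} ≤ z`, `1 ≤ u`, `2 ≤ D`
    have hu_eq : Core.uu D εI = (x : ℝ) ^ (γ * εI ^ 2) := by
      rw [Core.uu_def, hDdef, ← Real.rpow_mul hx0.le]
    have hεI2 : εI ^ 2 ≤ 1 / 2 := by nlinarith
    have hzu : Core.uu D εI ≤ z := by
      rw [hu_eq, hzdef]
      exact Real.rpow_le_rpow_of_exponent_le hx1.le (by nlinarith)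
    have hu1 : 1 ≤ Core.uu D εI := by rw [hu_eq]; exact Real.one_le_rpow hx1.le (by positivity)
    have hD2 : 2 ≤ D := hz2.trans hzD
    -- the level `Q = x^{θ'}`
    have hQ : WF.levelQ D εI = (x : ℝ) ^ θ' := by
      rw [WF.levelQ, hDdef, ← Real.rpow_mul hx0.le, ← hη, show γ * (1 + η + 2 * εI) = θ' from hγθ]
    have hQx : WF.levelQ D εI ≤ (x : ℝ) := by
      rw [hQ]; conv_rhs => rw [← Real.rpow_one (x : ℝ)]
      exact Real.rpow_le_rpow_of_exponent_le hx1.le hθ'1.le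
    have hNx : ⌊WF.levelQ D εI⌋₊ ≤ x := by
      have := Nat.floor_le_floor hQx
      rwa [Nat.floor_natCast] at this
    have hNQ : (⌊WF.levelQ D εI⌋₊ : ℝ) ≤ (x : ℝ) ^ θ' := by rw [← hQ]; exact Nat.floor_le (by rw [hQ]; positivity)
    -- the sieve
    set A := twinSeq x with hA
    have hsize : 0 ≤ A.size ((x + 2 : ℕ) : ℝ) := size_twinSeq_nonneg hx2
    have hS := WF.sifted_le_wellFactorable hD1 hεI (by linarith) A hK1 (hasIwaniecDimension_twinSeq x)
      hKu hsqrt.1 hsqrt.2 (Or.inr hεI1) hCd hCdF hCdf hz2 hzD hzu ((x + 2 : ℕ) : ℝ) hsize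
    rw [sifted_twinSeq_primesProdBelow, densityProduct_twinSeq_primesProdBelow, hratio] at hS
    have hF2 : upperSieveFun 1 2 = G := by
      rw [upperSieveFun_one_eq_holds (s := 2) ⟨by norm_num, by norm_num⟩, hG]; ring
    rw [hF2] at hS
    -- the size is `π(x) - 1`
    have hsz : A.size ((x + 2 : ℕ) : ℝ) = (Nat.primeCounting x : ℝ) - 1 := rfl
    -- (i) the well-factorable sums
    have hU : ((Core.Univ hD1 hεI).card : ℝ) ≤ L₁ := by
      rw [hL₁]; exact_mod_cast Core.card_Univ_le hD1 hεI hD2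
    have hWF : ∑ k ∈ Core.Univ hD1 hεI, ∑ q ∈ Icc 1 ⌊WF.levelQ D εI⌋₊,
        WF.wfLam hD1 hεI z k q * A.remainder q ((x + 2 : ℕ) : ℝ) ≤
          L₁ * (C * x / Real.log x ^ 3 + (x : ℝ) ^ θ') := by
      have hk : ∀ k ∈ Core.Univ hD1 hεI, ∑ q ∈ Icc 1 ⌊WF.levelQ D εI⌋₊,
          WF.wfLam hD1 hεI z k q * A.remainder q ((x + 2 : ℕ) : ℝ) ≤ C * x / Real.log x ^ 3 + (x : ℝ) ^ θ' := by
        intro k _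
        rw [hA, sum_mul_remainder_twinSeq_eq hx2]
        have hwf : IsWellFactorable (WF.levelQ D εI) (WF.wfLam hD1 hεI z k) :=
          WF.isWellFactorable_wfLam hD1 hεI (by linarith) z k
        have h1 := hC (x : ℝ) hxx₀ (WF.levelQ D εI) (by rw [hQ]) (WF.wfLam hD1 hεI z k) hwf
        rw [Nat.floor_natCast, show (3 : ℝ) = ((3 : ℕ) : ℝ) by norm_num, Real.rpow_natCast] at h1
        have h2 := (le_abs_self _).trans
          (abs_sum_div_totient_le ⌊WF.levelQ D εI⌋₊ (WF.abs_wfLam_le_one hD1 hεI z k))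
        exact add_le_add ((le_abs_self _).trans h1) (h2.trans hNQ)
      calc ∑ k ∈ Core.Univ hD1 hεI, ∑ q ∈ Icc 1 ⌊WF.levelQ D εI⌋₊,
            WF.wfLam hD1 hεI z k q * A.remainder q ((x + 2 : ℕ) : ℝ)
          ≤ ∑ _k ∈ Core.Univ hD1 hεI, (C * x / Real.log x ^ 3 + (x : ℝ) ^ θ') := Finset.sum_le_sum hk
        _ = (Core.Univ hD1 hεI).card * (C * x / Real.log x ^ 3 + (x : ℝ) ^ θ') := by
            rw [Finset.sum_const, nsmul_eq_mul]
        _ ≤ L₁ * (C * x / Real.log x ^ 3 + (x : ℝ) ^ θ') := mul_le_mul_of_nonneg_right hU (by positivity)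
    -- (ii) the junk
    have hJ : ((Core.Univ hD1 hεI).card : ℝ) * ∑ q ∈ WF.junkSet D εI z, |A.remainder q ((x + 2 : ℕ) : ℝ)| ≤
        L₁ * (8 * x * (1 + Real.log x) ^ 3 / (x : ℝ) ^ (γ * εI ^ 2)) := by
      have h := sum_junkSet_abs_remainder_le (D := D) (ε := εI) (z := z) hx2 hNx hu1
      rw [hu_eq] at h
      exact mul_le_mul hU h (Finset.sum_nonneg fun q _ => abs_nonneg _) hL₁0
    -- (iii) assemble
    rw [hlogD, hsz, ← hc₀] at hS
    have h1 := TwinSieveFour.twinPrimeCount_le_roughCount_add_real x hz0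
    calc (twinPrimeCount x : ℝ) ≤ roughCount (twinSieveSet x) ⌈z⌉₊ + (z + 1) := h1
      _ ≤ (((Nat.primeCounting x : ℝ) - 1) * sieveProduct 2 z *
              (G + c₀ * (εI + εI⁻¹ ^ 8 * Real.exp K / (γ * Real.log x))) +
            L₁ * (C * x / Real.log x ^ 3 + (x : ℝ) ^ θ') +
            L₁ * (8 * x * (1 + Real.log x) ^ 3 / (x : ℝ) ^ (γ * εI ^ 2))) + (z + 1) := by
          linarith [hS, hWF, hJ]
      _ = M x := by simp only [hM, hE, hzdef]
  -- (b) `M(x) (log x)²/x → (4/γ) C₂ e^{-γ_E} (G + c₀ εI)`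
  have hlim : Tendsto (fun x : ℕ => M x * (Real.log x ^ 2 / x)) atTop
      (𝓝 (2 / γ * (1 + c₀ * εI * Real.exp (-Real.eulerMascheroniConstant)) * (2 * twinPrimeConst))) := by
    have hT1 := TwinSieveFour.tendsto_primeCounting_sub_one_mul_log_div
    have hT2 := tendsto_sieveProduct_two_rpow_mul_log (β := γ / 2) (by positivity)
    have hT3 : Tendsto E atTop (𝓝 (c₀ * εI)) := by
      have h0 : Tendsto (fun x : ℕ => εI⁻¹ ^ 8 * Real.exp K / (γ * Real.log x)) atTop (𝓝 0) :=
        tendsto_const_nhds.div_atTop (hlog.const_mul_atTop hγ0)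
      have h := (tendsto_const_nhds (x := εI)).add h0
      rw [add_zero] at h
      have h' := h.const_mul c₀
      refine h'.congr fun x => ?_
      simp only [hE]
    have hT4 : Tendsto (fun x : ℕ => L₁ * (C * x / Real.log x ^ 3 + (x : ℝ) ^ θ') * (Real.log x ^ 2 / x)) atTop
        (𝓝 0) := by
      have ha : Tendsto (fun x : ℕ => C / Real.log (x : ℝ)) atTop (𝓝 0) := tendsto_const_nhds.div_atTop hlog
      have hb := TwinSieveFour.tendsto_log_sq_div_rpow (1 - θ') (by linarith)
      have h := (ha.add hb).const_mul L₁
      rw [add_zero, mul_zero] at h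
      refine h.congr' ?_
      filter_upwards [eventually_gt_atTop 1] with x hx
      have hx1 : (1 : ℝ) < x := by exact_mod_cast hx
      have hx0 : (0 : ℝ) < x := by linarith
      have hlog0 : 0 < Real.log x := Real.log_pos hx1
      have e1 : (x : ℝ) ^ (1 - θ') = x / (x : ℝ) ^ θ' := by rw [Real.rpow_sub hx0, Real.rpow_one]
      rw [e1]
      have hxθ : (0 : ℝ) < (x : ℝ) ^ θ' := Real.rpow_pos_of_pos hx0 _
      field_simp
    have hT5 : Tendsto (fun x : ℕ => L₁ * (8 * x * (1 + Real.log x) ^ 3 / (x : ℝ) ^ (γ * εI ^ 2)) *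
        (Real.log x ^ 2 / x)) atTop (𝓝 0) := by
      have h := (tendsto_one_add_log_pow_div_rpow (γ * εI ^ 2) (by positivity)).const_mul (8 * L₁)
      rw [mul_zero] at h
      refine squeeze_zero' ?_ ?_ h
      · filter_upwards [eventually_gt_atTop 0] with x hx
        have hx0 : (0 : ℝ) < x := by exact_mod_cast hx
        have : 0 ≤ Real.log (x : ℝ) := Real.log_nonneg (by exact_mod_cast hx)
        positivity
      · filter_upwards [eventually_gt_atTop 1] with x hx
        have hx1 : (1 : ℝ) < x := by exact_mod_cast hx
        have hx0 : (0 : ℝ) < x := by linarith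
        have hl0 : 0 ≤ Real.log (x : ℝ) := Real.log_nonneg hx1.le
        have hxa : (0 : ℝ) < (x : ℝ) ^ (γ * εI ^ 2) := Real.rpow_pos_of_pos hx0 _
        have e1 : L₁ * (8 * x * (1 + Real.log x) ^ 3 / (x : ℝ) ^ (γ * εI ^ 2)) * (Real.log x ^ 2 / x) =
            8 * L₁ * ((1 + Real.log x) ^ 3 * Real.log x ^ 2 / (x : ℝ) ^ (γ * εI ^ 2)) := by
          field_simp
        rw [e1]
        refine mul_le_mul_of_nonneg_left ?_ (by positivity)
        apply div_le_div_of_nonneg_right _ hxa.le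
        have h2 : Real.log (x : ℝ) ^ 2 ≤ (1 + Real.log x) ^ 2 := by gcongr; linarith
        calc (1 + Real.log (x : ℝ)) ^ 3 * Real.log x ^ 2 ≤ (1 + Real.log x) ^ 3 * (1 + Real.log x) ^ 2 :=
              mul_le_mul_of_nonneg_left h2 (by positivity)
          _ = (1 + Real.log x) ^ 5 := by ring
    have hT6 : Tendsto (fun x : ℕ => ((x : ℝ) ^ (γ / 2) + 1) * (Real.log x ^ 2 / x)) atTop (𝓝 0) := by
      have ha := TwinSieveFour.tendsto_log_sq_div_rpow (1 - γ / 2) (by linarith)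
      have hb := TwinSieveFour.tendsto_log_sq_div_rpow 1 one_pos
      have h := ha.add hb
      rw [add_zero] at h
      refine h.congr' ?_
      filter_upwards [eventually_gt_atTop 0] with x hx
      have hx0 : (0 : ℝ) < x := by exact_mod_cast hx
      have e1 : (x : ℝ) ^ (1 - γ / 2) = x / (x : ℝ) ^ (γ / 2) := by rw [Real.rpow_sub hx0, Real.rpow_one]
      rw [e1, Real.rpow_one]
      have : (0 : ℝ) < (x : ℝ) ^ (γ / 2) := Real.rpow_pos_of_pos hx0 _
      field_simp
    have hsum := ((((hT1.mul hT2).mul ((tendsto_const_nhds (x := G)).add hT3)).add hT4).add hT5).add hT6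
    have hval : 1 * (2 / (γ / 2) * twinPrimeConst * Real.exp (-Real.eulerMascheroniConstant)) * (G + c₀ * εI) +
        0 + 0 + 0 = 2 / γ * (1 + c₀ * εI * Real.exp (-Real.eulerMascheroniConstant)) * (2 * twinPrimeConst) := by
      rw [hG, Real.exp_neg]
      field_simp
      ring
    rw [hval] at hsum
    refine hsum.congr' ?_
    filter_upwards [eventually_gt_atTop 1] with x hx
    have hx1 : (1 : ℝ) < x := by exact_mod_cast hx
    have hx0 : (0 : ℝ) < x := by linarith
    have hlog0 : 0 < Real.log x := Real.log_pos hx1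
    simp only [hM]
    field_simp
  -- (c) conclusion
  have hC2 : 0 < twinPrimeConst := twinPrimeConst_pos_holds
  set ℓ := 2 / γ * (1 + c₀ * εI * Real.exp (-Real.eulerMascheroniConstant)) with hℓ
  have hlt : ℓ * (2 * twinPrimeConst) < (ℓ + τ) * 2 * twinPrimeConst := by nlinarith
  filter_upwards [hle, hlim.eventually (gt_mem_nhds hlt), eventually_gt_atTop 1] with x hxle hxlt hx
  have hx1 : (1 : ℝ) < x := by exact_mod_cast hx
  have hx0 : (0 : ℝ) < x := by linarith
  have hlog0 : 0 < Real.log x := Real.log_pos hx1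
  have hpos : 0 < Real.log x ^ 2 / x := by positivity
  have hM' : M x < (ℓ + τ) * 2 * twinPrimeConst * x / Real.log x ^ 2 := by
    rw [← div_div_eq_mul_div]
    exact (lt_div_iff₀ hpos).mpr hxlt
  exact hxle.trans hM'.le

/-- **`TwinSieveUpperBound (7/2)` from BFI's Theorem 10** (`π`-form): for every `ε > 0`, eventually
`π₂(x) ≤ (7/2 + ε) · 2 C₂ x/(log x)²`.  Take `ε_I = ε_B = δ` in `eventually_twinPrimeCount_le`, where
`δ ↦ (2/γ(δ))(1 + c₀ δ e^{−γ})` is continuous at `0` with value `7/2`.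
[cite: BombieriFriedlanderIwaniecActa1986, §1 Corollary 2] -/
theorem twinSieveUpperBound_of_theorem10Pi (h10 : BombieriFriedlanderIwaniecTheorem10Pi) :
    TwinSieveUpperBound (7 / 2) := by
  intro ε hε
  obtain ⟨Cd, hCd, hCdF, hCdf⟩ := Iwaniec1980b.exists_linearSieve_decay
  set c₀ := 5e24 * (1 + Cd) ^ 2 with hc₀
  set g : ℝ → ℝ := fun δ => 2 / ((4 / 7 - δ) / (1 + δ ^ 9 + 2 * δ)) *
    (1 + c₀ * δ * Real.exp (-Real.eulerMascheroniConstant)) with hg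
  have hg0 : g 0 = 7 / 2 := by simp only [hg]; norm_num
  have hcont : ContinuousAt g 0 := by
    simp only [hg]
    refine ContinuousAt.mul (ContinuousAt.div continuousAt_const ?_ (by norm_num)) (by fun_prop)
    exact ContinuousAt.div (by fun_prop) (by fun_prop) (by norm_num)
  obtain ⟨ρ, hρ, hρg⟩ := Metric.continuousAt_iff.mp hcont (ε / 2) (by positivity)
  set δ := min (ρ / 2) (1 / 30) with hδ
  have hδ0 : 0 < δ := by positivity
  have hδ1 : δ ≤ 1 / 30 := min_le_right _ _
  have hδρ : dist δ 0 < ρ := by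
    rw [Real.dist_eq, sub_zero, abs_of_pos hδ0]
    linarith [min_le_left (ρ / 2) (1 / 30)]
  have hgδ : g δ < 7 / 2 + ε / 2 := by
    have h := hρg hδρ
    rw [hg0, Real.dist_eq] at h
    linarith [le_abs_self (g δ - 7 / 2)]
  have hev := eventually_twinPrimeCount_le h10 hδ0 hδ1 hδ0 (by linarith) hCd hCdF hCdf (τ := ε / 2) (by positivity)
  have hC2 : 0 < twinPrimeConst := twinPrimeConst_pos_holds
  filter_upwards [hev, eventually_gt_atTop 1] with x hx hx1
  refine hx.trans ?_
  have hx1' : (1 : ℝ) < x := by exact_mod_cast hx1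
  have hlog : 0 < Real.log x := Real.log_pos hx1'
  have h0 : (0 : ℝ) ≤ 2 * twinPrimeConst * x / Real.log x ^ 2 := by positivity
  have hgδ' : 2 / ((4 / 7 - δ) / (1 + Core.eta δ + 2 * δ)) *
      (1 + 5e24 * (1 + Cd) ^ 2 * δ * Real.exp (-Real.eulerMascheroniConstant)) = g δ := by
    simp only [hg, hc₀, Core.eta]
  calc (2 / ((4 / 7 - δ) / (1 + Core.eta δ + 2 * δ)) *
          (1 + 5e24 * (1 + Cd) ^ 2 * δ * Real.exp (-Real.eulerMascheroniConstant)) + ε / 2) *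
        2 * twinPrimeConst * x / Real.log x ^ 2
      = (g δ + ε / 2) * (2 * twinPrimeConst * x / Real.log x ^ 2) := by rw [hgδ']; ring
    _ ≤ (7 / 2 + ε) * (2 * twinPrimeConst * x / Real.log x ^ 2) :=
        mul_le_mul_of_nonneg_right (by linarith) h0
    _ = (7 / 2 + ε) * 2 * twinPrimeConst * x / Real.log x ^ 2 := by ring

end TwinSieveBFI

/-- **Bombieri–Friedlander–Iwaniec 1986, Corollary 2, from their Theorem 10** (`π`-form):
`BombieriFriedlanderIwaniecTheorem10Pi → twinSieve_bfi`, i.e. the primes having well-factorable level of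
distribution `x^{4/7−ε}` (in the `π`-form of Maynard's restatement) implies
`π₂(x) ≤ (7/2 + o(1)) · 2 C₂ x/(log x)²` — "an immediate consequence of Theorem 10 and of the linear sieve
result of [15]" (p. 251), the latter being the PROVED `Iwaniec1980b.WF.sifted_le_wellFactorable`.  The
discharge `twinSieve_bfi_holds` follows from this theorem as soon as `BombieriFriedlanderIwaniecTheorem10Pi` is
a theorem of the tree (its leaves: BFI Theorems 1, 2, 5*). [cite: BombieriFriedlanderIwaniecActa1986, §1 Corollary 2 and §17 p. 251] -/
theorem twinSieve_bfi_of_theorem10Pi (h10 : BombieriFriedlanderIwaniecTheorem10Pi) : twinSieve_bfi :=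
  TwinSieveBFI.twinSieveUpperBound_of_theorem10Pi h10


end Literature.NumberTheory.Sieve

end
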